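import Summits.AtomisticToContinuum.BoseEinsteinCondensation.Theorems.PeriodicIRBound.Negative.Scaling
import HarnessLib

/-!
# Route `BECGroundStateSOS`, crux `PeriodicIRBound` (stmt-AtomisticToContinuum-3972), line
# `hardcore-monotone-class-uniformity` — by-product stub `stub_classScaling`: WLOG unit range for `C⁺`

The line's hardest stub `C⁺(R₀)` (the crux's infrared inequality on the class of BOUNDED admissible
potentials of range `≤ R₀`, with class-uniform data `(ρ₀, C)`, `N`-threshold and slack) only has to be
proved at unit range: `C⁺(1) ⇒ C⁺(R₀)` for every `R₀ > 0`, with `(κ, ρ₀, C) ↦ (κ, ρ₀/R₀³, C√R₀)` read off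
at window `κ/√R₀`. This is the CLASS form of the per-potential scaling covariance of the crux
(`Negative.irBoundWith_scaledPotential`, Disproof §13): a class member `w` of range `≤ R₀` is the dilate
`b⁻²u(·/b)`, `b = R₀`, of the unit-range class member `u = b²w(b·)` (bounded, admissible); a
`b⁻²δ`-near-minimiser of `w` on the torus `L_N(ρ/b³) = bL_N(ρ)` pulls back to a `δ`-near-minimiser of
`u` on `L_N(ρ)` (energies scale EXACTLY by `b²`, `periodicEnergy_dilate`,
`periodicGroundStateEnergy_scaledPotential`), plane-wave occupations are dilation invariant
(`cellOccupation_planeWaveMode_dilate`) and windows/bounds coincide. The point for the line: the pulled-back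
slack `b⁻²δ_N` does not depend on the class member, so the class-uniform slack survives the dilation.

No new definitions: the statement is the registered stub signature, written over the landed vocabulary
`NearMin / InWindow / IRIneq` (`Negative.TwoModeStates`) and `scaledPotential`
(`Literature.Barriers.AtomisticToContinuum.KineticGapLengthScales`).
-/

noncomputable section

open MeasureTheory Filter
open scoped ENNReal NNReal

namespace Summit.AtomisticToContinuum.BoseEinsteinCondensation.Cruxes.PeriodicIRBound.HardcoreMonotoneClassUniformity

open Literature.MathematicalPhysics.QuantumManyBody.BoseGas
open Summit.AtomisticToContinuum.BoseEinsteinCondensation.Theorems.PeriodicIRBound.Negative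
  (NearMin InWindow IRIneq irIneq_iff cellOccupation_planeWaveMode_dilate sideLength_div_cube
    sqrt_mul_sqrt_div_cube)
open Literature.Barriers.AtomisticToContinuum.BoseGas (scaledPotential periodicEnergy_dilate
  periodicGroundStateEnergy_scaledPotential isRepulsiveFiniteRange_scaledPotential
  scaledPotential_scaledPotential_inv)

/-- **WLOG unit range for the class-uniform infrared bound** (registered by-product stub of line
`hardcore-monotone-class-uniformity`): if ONE slack per `N` serves every bounded admissible potential of
range `≤ 1` (window `κ`, data `(ρ₀, C)`), then for every `R₀ > 0` one slack per `N` serves every bounded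
admissible potential of range `≤ R₀` (window `κ`, data `(ρ₀/R₀³, C√R₀)`, the unit-range data being read at
window `κ/√R₀`). Dilation `w = R₀⁻²u(·/R₀)`, `u` of unit range; the slack `R₀⁻²δ_N` is member-independent.
[folklore] -/
theorem stub_classScaling :
    (∀ κ : ℝ, 0 < κ → ∃ ρ₀ : ℝ, 0 < ρ₀ ∧ ∃ C : ℝ, 0 < C ∧ ∀ ρ : ℝ, 0 < ρ → ρ < ρ₀ →
      ∀ᶠ N : ℕ in atTop, ∃ δ : ℝ≥0∞, 0 < δ ∧
        ∀ w : ℝ → ℝ≥0∞, IsRepulsiveFiniteRange w → (∀ r, 1 < r → w r = 0) →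
          (∃ M : ℝ≥0∞, M ≠ ⊤ ∧ ∀ r, w r ≤ M) →
          ∀ Ψ : PeriodicTrialState N (sideLength ρ N), NearMin w ρ N δ Ψ →
            ∀ k : Fin 3 → ℤ, InWindow κ ρ N k → IRIneq C ρ N Ψ.ψ k) →
    ∀ R₀ : ℝ, 0 < R₀ → ∀ κ : ℝ, 0 < κ → ∃ ρ₀ : ℝ, 0 < ρ₀ ∧ ∃ C : ℝ, 0 < C ∧ ∀ ρ : ℝ, 0 < ρ → ρ < ρ₀ →
      ∀ᶠ N : ℕ in atTop, ∃ δ : ℝ≥0∞, 0 < δ ∧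
        ∀ w : ℝ → ℝ≥0∞, IsRepulsiveFiniteRange w → (∀ r, R₀ < r → w r = 0) →
          (∃ M : ℝ≥0∞, M ≠ ⊤ ∧ ∀ r, w r ≤ M) →
          ∀ Ψ : PeriodicTrialState N (sideLength ρ N), NearMin w ρ N δ Ψ →
            ∀ k : Fin 3 → ℤ, InWindow κ ρ N k → IRIneq C ρ N Ψ.ψ k := by
  intro h b hb κ hκ
  obtain ⟨ρ₀, hρ₀, C, hC, hW⟩ := h (κ / Real.sqrt b) (by positivity)
  refine ⟨ρ₀ / b ^ 3, by positivity, C * Real.sqrt b, by positivity, fun ρ' hρ' hρ'lt => ?_⟩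
  have hb3 : 0 < b ^ 3 := pow_pos hb 3
  set ρ : ℝ := b ^ 3 * ρ' with hρdef
  have hρ : 0 < ρ := mul_pos hb3 hρ'
  have hρρ₀ : ρ < ρ₀ := by
    rw [lt_div_iff₀ hb3] at hρ'lt
    linarith [mul_comm ρ' (b ^ 3)]
  have hρ'eq : ρ' = ρ / b ^ 3 := by
    rw [hρdef]; field_simp
  filter_upwards [hW ρ hρ hρρ₀, eventually_gt_atTop 0] with N ⟨δ, hδ, hN⟩ hNpos
  have hL' : sideLength ρ' N = b * sideLength ρ N := by
    rw [hρ'eq]; exact sideLength_div_cube hρ hb N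
  have hM : sideLength ρ N = b⁻¹ * sideLength ρ' N := by
    rw [hL', inv_mul_cancel_left₀ hb.ne']
  set B : ℝ≥0∞ := ENNReal.ofReal (b ^ 2) with hB
  have hB0 : B ≠ 0 := by rw [hB]; simpa using hb.ne'
  have hBtop : B ≠ ⊤ := ENNReal.ofReal_ne_top
  refine ⟨B⁻¹ * δ, ENNReal.mul_pos (ENNReal.inv_ne_zero.2 hBtop) hδ.ne', fun w hw hwR hwb Ψ hΨ k hk => ?_⟩
  -- the unit-range class member `u = b² w(b ·)` with `w = b⁻² u(·/b)`
  set u : ℝ → ℝ≥0∞ := scaledPotential w b⁻¹ with hudef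
  have hwu : scaledPotential u b = w := by
    have := scaledPotential_scaledPotential_inv (inv_pos.2 hb) w
    rwa [inv_inv] at this
  have hu : IsRepulsiveFiniteRange u := isRepulsiveFiniteRange_scaledPotential hw (inv_pos.2 hb)
  have huR : ∀ r, 1 < r → u r = 0 := by
    intro r hr
    have hbr : b < r * b := by nlinarith
    simp [hudef, scaledPotential, div_inv_eq_mul, hwR _ hbr]
  have hub : ∃ M : ℝ≥0∞, M ≠ ⊤ ∧ ∀ r, u r ≤ M := by
    obtain ⟨M, hMtop, hM⟩ := hwb
    refine ⟨(ENNReal.ofReal (b⁻¹ ^ 2))⁻¹ * M, ENNReal.mul_ne_top ?_ hMtop, fun r => ?_⟩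
    · exact ENNReal.inv_ne_top.2 (by simpa using hb.ne')
    · simp only [hudef, scaledPotential]
      exact mul_le_mul_right (hM _) _
  have hΨ' : NearMin (scaledPotential u b) ρ' N (B⁻¹ * δ) Ψ := by rwa [hwu]
  -- pull the state back to the torus of side `L_N(ρ)`
  set Φ : PeriodicTrialState N (sideLength ρ N) := Ψ.dilate b⁻¹ (inv_pos.2 hb) hM with hΦdef
  have hE : periodicEnergy u Φ = B * periodicEnergy (scaledPotential u b) Ψ := by
    have := periodicEnergy_dilate (inv_pos.2 hb) hM (scaledPotential u b) Ψ
    rw [scaledPotential_scaledPotential_inv hb] at this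
    rw [hΦdef, this, hB, inv_pow, ENNReal.ofReal_inv_of_pos (by positivity), inv_inv]
  have hE0 : periodicGroundStateEnergy (scaledPotential u b) N (sideLength ρ' N) =
      B⁻¹ * periodicGroundStateEnergy u N (sideLength ρ N) := by
    rw [hL']; exact periodicGroundStateEnergy_scaledPotential hb u N
  have hΦ : NearMin u ρ N δ Φ := by
    unfold NearMin at hΨ' ⊢
    rw [hE0, ← mul_add] at hΨ'
    rw [hE]
    calc B * periodicEnergy (scaledPotential u b) Ψ
        ≤ B * (B⁻¹ * (periodicGroundStateEnergy u N (sideLength ρ N) + δ)) := mul_le_mul_right hΨ' _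
      _ = periodicGroundStateEnergy u N (sideLength ρ N) + δ := by
          rw [← mul_assoc, ENNReal.mul_inv_cancel hB0 hBtop, one_mul]
  -- the windows coincide
  have hid : Real.sqrt b * Real.sqrt ρ' * sideLength ρ' N = Real.sqrt ρ * sideLength ρ N := by
    rw [hL', hρ'eq]
    exact sqrt_mul_sqrt_div_cube hρ.le hb (sideLength ρ N)
  have hwin : InWindow (κ / Real.sqrt b) ρ N k := by
    refine ⟨hk.1, ?_⟩
    have hsb : 0 < Real.sqrt b := Real.sqrt_pos.2 hb
    calc ‖(fun j => (k j : ℝ))‖ ≤ κ * Real.sqrt ρ' * sideLength ρ' N := hk.2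
      _ = κ / Real.sqrt b * (Real.sqrt b * Real.sqrt ρ' * sideLength ρ' N) := by
          field_simp
      _ = κ / Real.sqrt b * Real.sqrt ρ * sideLength ρ N := by rw [hid]; ring
  have key := hN u hu huR hub Φ hΦ k hwin
  rw [irIneq_iff] at key ⊢
  rw [hΦdef, cellOccupation_planeWaveMode_dilate (inv_pos.2 hb) hM Ψ k] at key
  refine key.trans_eq ?_
  congr 1
  calc C * Real.sqrt ρ * sideLength ρ N / ‖(fun j => (k j : ℝ))‖
      = C * (Real.sqrt b * Real.sqrt ρ' * sideLength ρ' N) / ‖(fun j => (k j : ℝ))‖ := by rw [hid]; ring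
    _ = C * Real.sqrt b * Real.sqrt ρ' * sideLength ρ' N / ‖(fun j => (k j : ℝ))‖ := by ring

end Summit.AtomisticToContinuum.BoseEinsteinCondensation.Cruxes.PeriodicIRBound.HardcoreMonotoneClassUniformity

end
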